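import Mathlib.Analysis.Normed.Module.Alternating.Curry
import Mathlib.Topology.Algebra.Module.Alternating.Basic
import Mathlib.Data.Fin.Tuple.Basic
import HarnessLib

-- provenance: harness21/H21/H21/Prelude/Kaehler/AlternatingAux.lean @ c423f1e (interim HEAD d8f2665); M5 mechanical rewrite
/-!
# Auxiliary constructions on continuous alternating maps (trunk: Kähler / Hodge, item K1)

Two small gaps in Mathlib's API for continuous alternating maps `V [⋀^ι]→L[𝕜] W`, needed by the
linear-algebraic Hodge star (`H21/Prelude/Kaehler/HodgeStar.lean`) supporting the notion
`riemannian_metric`: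

* `ContinuousAlternatingMap.domDomCongr σ f`: reindexing the arguments of a continuous alternating
  map along an equivalence `σ : ι ≃ ι'`. Mathlib has `AlternatingMap.domDomCongr` and
  `ContinuousMultilinearMap.domDomCongr` but (as of the pinned Mathlib) no continuous alternating
  version; we combine the two.
* `ContinuousAlternatingMap.interiorProductMulti k α v`: the iterated interior product (contraction)
  `ι_{v (k-1)} ⋯ ι_{v 0} α` of an `(m + k)`-form with `k` vectors, defined by recursion on `k` via
  Mathlib's `ContinuousAlternatingMap.curryLeft`.

Not added (Mathlib already has them): evaluation as a continuous linear map
(`ContinuousAlternatingMap.apply`), alternatization (`ContinuousMultilinearMap.alternatization`).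

## Design notes

* The declarations in this file are *deliberate* dot-notation extensions of the Mathlib namespace
  `ContinuousAlternatingMap` (they are candidates for upstreaming); nothing else is put in Mathlib
  namespaces.
* In `interiorProductMulti` the degree `m` of the result is implicit; when the expected type does
  not determine it, callers write `α.interiorProductMulti (m := m) k v`.
* Vectors are inserted from the left, first `v 0`, then `v 1`, …, so that
  `α.interiorProductMulti k v w = α (Fin.append v w ∘ Fin.cast _)` (`interiorProductMulti_apply`).

## References

* F. W. Warner, *Foundations of Differentiable Manifolds and Lie Groups* (1983), §2.10–2.11
  (interior multiplication), Ex. 2.13 (Hodge star).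
* Mathlib, `Mathlib/LinearAlgebra/Alternating/DomCoprod.lean`, `AlternatingMap.domDomCongr` in
  `Mathlib/LinearAlgebra/Alternating/Basic.lean`.
-/

noncomputable section

namespace ContinuousAlternatingMap

section DomDomCongr

variable {𝕜 : Type*} [NontriviallyNormedField 𝕜] {V W : Type*} [NormedAddCommGroup V]
  [NormedSpace 𝕜 V] [NormedAddCommGroup W] [NormedSpace 𝕜 W] {ι ι' ι'' : Type*}

/-- Reindex the arguments of a continuous alternating map along an equivalence `σ : ι ≃ ι'`:
`(f.domDomCongr σ) v = f (v ∘ σ)`. This is the continuous analogue of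
`AlternatingMap.domDomCongr` (Mathlib, `LinearAlgebra/Alternating/Basic.lean`), built on
`ContinuousMultilinearMap.domDomCongr`. Deliberate extension of the Mathlib namespace. [folklore] -/
def domDomCongr (σ : ι ≃ ι') (f : V [⋀^ι]→L[𝕜] W) : V [⋀^ι']→L[𝕜] W :=
  { f.toContinuousMultilinearMap.domDomCongr σ with
    map_eq_zero_of_eq' := fun v i j hv hij =>
      f.map_eq_zero_of_eq (v ∘ σ) (i := σ.symm i) (j := σ.symm j)
        (by simpa using hv) (σ.symm.injective.ne hij) }

/-- Evaluation of a reindexed continuous alternating map: `(f.domDomCongr σ) v = f (v ∘ σ)`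
(cf. `AlternatingMap.domDomCongr_apply` in Mathlib). [folklore] -/
@[simp]
theorem domDomCongr_apply (σ : ι ≃ ι') (f : V [⋀^ι]→L[𝕜] W) (v : ι' → V) :
    f.domDomCongr σ v = f (v ∘ σ) :=
  rfl

/-- The underlying continuous multilinear map of `f.domDomCongr σ` is
`f.toContinuousMultilinearMap.domDomCongr σ` (by construction). [folklore] -/
@[simp]
theorem toContinuousMultilinearMap_domDomCongr (σ : ι ≃ ι') (f : V [⋀^ι]→L[𝕜] W) :
    (f.domDomCongr σ).toContinuousMultilinearMap = f.toContinuousMultilinearMap.domDomCongr σ :=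
  rfl

/-- The underlying alternating map of `f.domDomCongr σ` is `f.toAlternatingMap.domDomCongr σ`
(cf. `AlternatingMap.domDomCongr` in Mathlib). [folklore] -/
@[simp]
theorem toAlternatingMap_domDomCongr (σ : ι ≃ ι') (f : V [⋀^ι]→L[𝕜] W) :
    (f.domDomCongr σ).toAlternatingMap = f.toAlternatingMap.domDomCongr σ :=
  rfl

/-- Reindexing along the identity equivalence does nothing
(cf. `AlternatingMap.domDomCongr_refl` in Mathlib). [folklore] -/
@[simp]
theorem domDomCongr_refl (f : V [⋀^ι]→L[𝕜] W) : f.domDomCongr (Equiv.refl ι) = f :=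
  rfl

/-- Reindexing is compatible with composition of equivalences
(cf. `AlternatingMap.domDomCongr_trans` in Mathlib). [folklore] -/
theorem domDomCongr_trans (σ₁ : ι ≃ ι') (σ₂ : ι' ≃ ι'') (f : V [⋀^ι]→L[𝕜] W) :
    f.domDomCongr (σ₁.trans σ₂) = (f.domDomCongr σ₁).domDomCongr σ₂ :=
  rfl

/-- Reindexing is additive in the map (cf. `AlternatingMap.domDomCongr_add` in Mathlib). [folklore] -/
@[simp]
theorem domDomCongr_add (σ : ι ≃ ι') (f g : V [⋀^ι]→L[𝕜] W) :
    (f + g).domDomCongr σ = f.domDomCongr σ + g.domDomCongr σ :=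
  rfl

/-- Reindexing commutes with scalar multiplication
(cf. `AlternatingMap.domDomCongr_smul` in Mathlib). [folklore] -/
@[simp]
theorem domDomCongr_smul (σ : ι ≃ ι') (c : 𝕜) (f : V [⋀^ι]→L[𝕜] W) :
    (c • f).domDomCongr σ = c • f.domDomCongr σ :=
  rfl

/-- Reindexing the zero map gives the zero map
(cf. `AlternatingMap.domDomCongr_zero` in Mathlib). [folklore] -/
@[simp]
theorem domDomCongr_zero (σ : ι ≃ ι') : (0 : V [⋀^ι]→L[𝕜] W).domDomCongr σ = 0 :=
  rfl

end DomDomCongr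

section InteriorProduct

variable {𝕜 : Type*} [NontriviallyNormedField 𝕜] {V W : Type*} [NormedAddCommGroup V]
  [NormedSpace 𝕜 V] [NormedAddCommGroup W] [NormedSpace 𝕜 W] {m : ℕ}

/-- Iterated interior product (contraction) of a continuous alternating `(m + k)`-form `α` with
`k` vectors `v 0, …, v (k-1)`, inserted successively in the first slot:
`interiorProductMulti 0 α v = α` and
`interiorProductMulti (k+1) α v = interiorProductMulti k (α.curryLeft (v 0)) (Fin.tail v)`,
so that `α.interiorProductMulti k v w = α (v 0, …, v (k-1), w 0, …, w (m-1))`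
(`interiorProductMulti_apply`). See Warner, *Foundations of Differentiable Manifolds and Lie
Groups*, §2.10 (interior multiplication). The result degree `m` is implicit; pass `(m := m)` when
the expected type does not fix it. Deliberate extension of the Mathlib namespace. [folklore] -/
def interiorProductMulti :
    (k : ℕ) → (V [⋀^Fin (m + k)]→L[𝕜] W) → (Fin k → V) → V [⋀^Fin m]→L[𝕜] W
  | 0, α, _ => α
  | k + 1, α, v => interiorProductMulti k (α.curryLeft (v 0)) (Fin.tail v)

/-- Contracting with no vectors does nothing (defining equation of `interiorProductMulti`). [folklore] -/
@[simp]
theorem interiorProductMulti_zero (α : V [⋀^Fin (m + 0)]→L[𝕜] W) (v : Fin 0 → V) :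
    α.interiorProductMulti 0 v = α :=
  rfl

/-- Contracting with `k + 1` vectors is contracting `α.curryLeft (v 0)` with the remaining `k`
vectors (defining equation of `interiorProductMulti`). [folklore] -/
@[simp]
theorem interiorProductMulti_succ (k : ℕ) (α : V [⋀^Fin (m + (k + 1))]→L[𝕜] W)
    (v : Fin (k + 1) → V) :
    α.interiorProductMulti (k + 1) v = (α.curryLeft (v 0)).interiorProductMulti k (Fin.tail v) :=
  rfl

/-- Explicit formula for the iterated interior product: the vectors `v` fill the first `k` slots
and the remaining arguments `w` the last `m` slots,
`α.interiorProductMulti k v w = α (Fin.append v w ∘ Fin.cast _)`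
(Warner, *Foundations*, §2.10). [folklore] -/
theorem interiorProductMulti_apply {k : ℕ} (α : V [⋀^Fin (m + k)]→L[𝕜] W) (v : Fin k → V)
    (w : Fin m → V) :
    α.interiorProductMulti k v w = α (Fin.append v w ∘ Fin.cast (Nat.add_comm m k)) := by
  induction k generalizing m with
  | zero =>
    simp only [interiorProductMulti]
    congr 1
    ext i
    simp [Fin.append, Fin.addCases]
  | succ k ih =>
    simp only [interiorProductMulti, ih, curryLeft_apply_apply]
    congr 1
    ext i
    refine Fin.cases ?_ (fun j => ?_) i
    · simp [Fin.append, Fin.addCases, Matrix.vecCons]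
      rfl
    · simp only [Matrix.cons_val_succ, Function.comp_apply]
      simp only [Fin.append, Fin.addCases, Fin.tail, Fin.val_cast, Fin.val_succ, eq_rec_constant]
      by_cases h : (j : ℕ) < k
      · have h' : (j : ℕ) + 1 < k + 1 := by omega
        simp only [h, h', dite_true]
        rfl
      · have h' : ¬ (j : ℕ) + 1 < k + 1 := by omega
        simp only [h, h', dite_false]
        congr 1
        ext; simp

/-- The iterated interior product is additive in the form
(Warner, *Foundations*, §2.10: `ι_v` is linear). [folklore] -/
@[simp]
theorem interiorProductMulti_add (k : ℕ) (α β : V [⋀^Fin (m + k)]→L[𝕜] W) (v : Fin k → V) :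
    (α + β).interiorProductMulti k v = α.interiorProductMulti k v + β.interiorProductMulti k v := by
  induction k generalizing m with
  | zero => rfl
  | succ k ih =>
    simp only [interiorProductMulti_succ, curryLeft_add, _root_.add_apply, ih]

/-- The iterated interior product commutes with scalar multiplication of the form
(Warner, *Foundations*, §2.10: `ι_v` is linear). [folklore] -/
@[simp]
theorem interiorProductMulti_smul (k : ℕ) (c : 𝕜) (α : V [⋀^Fin (m + k)]→L[𝕜] W)
    (v : Fin k → V) :
    (c • α).interiorProductMulti k v = c • α.interiorProductMulti k v := by
  induction k generalizing m with
  | zero => rfl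
  | succ k ih =>
    simp only [interiorProductMulti_succ, curryLeft_smul, _root_.smul_apply, ih]

/-- Contracting the zero form gives zero. [folklore] -/
@[simp]
theorem interiorProductMulti_zero_left (k : ℕ) (v : Fin k → V) :
    (0 : V [⋀^Fin (m + k)]→L[𝕜] W).interiorProductMulti k v = 0 := by
  induction k generalizing m with
  | zero => rfl
  | succ k ih => simp only [interiorProductMulti_succ, curryLeft_zero, _root_.zero_apply, ih]

end InteriorProduct

end ContinuousAlternatingMap
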